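import Summits.BirchSwinnertonDyer.BirchSwinnertonDyer.Theses.NormCapitulation

/-!
# Line `birth` (BC3 skeleton) for crux `NormCapitulation.NormHerbrandBound`
# (stmt-BirchSwinnertonDyer-17970, route `route-BirchSwinnertonDyer-NormCapitulation`, crux rank 9)

Registered by the skeleton registrar `planner-skel-stmt-BirchSwinnertonDyer-17970-0` (2026-08-17).

## The crux (recall)

`NormHerbrandBound` (HERBRAND BOUND, the junction of the route): for every elliptic `V/ℚ` (globally minimal),
every good ordinary `p ≥ 5` with `E[p]` irreducible, every Heegner field `K` (imaginary quadratic, `d_K < −4`,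
`(d_K, Np) = 1`, every `q ∣ N` split) and every anticyclotomic `ℤ_p`-extension `κ` of `K` with layers
`K_n = K̄^{κ⁻¹(pⁿℤ_p)}`: the `p`-adic UNIVERSAL-NORM DATUM (one `c` such that every layer `K_n` carries a point
`P_n ∈ E(K_n)` whose norm `N_{K_n/K} P_n = Σ_a σ_a • P_n` is not in `p^c E(K) + tors`) forces a BOUNDED
CAPITULATION KERNEL: `∃ C ∀ n ∀ ξ ∈ Ш(E/K)` (`p`-primary), `res_{K → K_n} ξ = 0 → p^C • ξ = 0`.

(Refuter birth vetting, 2026-08-17: layer-wise `∀ n ∃ C_n` is a theorem now — `finite_ker_shaRestriction`;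
the whole content of the crux is the UNIFORMITY `∃ C ∀ n`.)

## The line: capitulation ⊆ inflated `H¹(Gal(K_n/K), E(K_n))`, whose exponent a Herbrand count bounds
## uniformly once Mordell–Weil grows like `pⁿ + O(1)` up the tower

Three registered stubs, sorted from research to routine (the route header's foreseen two-layer split
`TowerRankGrowth → HerbrandCount → NormHerbrandBound`, with the inflation–restriction step made explicit):

* **S1 · `stub_towerRankGrowth`** (the IWASAWA INPUT; research-sized outside Howard's hypotheses): in the
  crux's regime (no universal-norm datum needed), `rank_ℤ E(K_n) ≤ pⁿ + C₁` for all `n`, where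
  `E(K_n) = E(K̄)^{Γ_{K_n}}` is `FixedPoints.addSubgroup (κ.layerSubgroup n) (V_K).geomPoints`. Mazur's
  growth-number conjecture in the indefinite anticyclotomic case; a THEOREM when `ρ_{E,p}` has big image and
  `p ∤ h_K d_K N`: `corank_Λ Sel_{p^∞}(E/K_∞) = 1` (Howard 2004 Thm B(b) — tree hypothesis-Prop
  `Howard2004_selmerCorank_le` under `HowardHypotheses`, `Literature/…/HeegnerModuleIndex.lean` — with the
  non-triviality of the Λ-adic Heegner class, Cornut 2002 / Cornut–Vatsal 2007; Bertolini 1995) plus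
  anticyclotomic control (`rank E(K_n) ≤ corank Sel_{p^∞}(E/K_n) ≤ pⁿ·1 + λ + O(1)`). OPEN in print in the
  irreducible-non-surjective (all CM curves, exceptional `p`) and `p ∣ h_K` sectors — the crux's own risk.
* **S2 · `stub_herbrandCount`** (INTEGRAL REPRESENTATION THEORY of `ℤ[ℤ/pⁿ]`-lattices; size L; no research
  obstruction): for ANY number field `K`, ANY `ℤ_p`-extension `κ`, ANY elliptic `W/K`: a universal-norm
  datum with constant `c` and the growth bound `rank E(K_n) ≤ pⁿ + C₁` give `C₂` with `p^{C₂}` killing every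
  class of `H¹(K, E)` inflated from a crossed homomorphism `Γ_K → E(K̄)` vanishing on `Γ_{K_n}`, i.e. killing
  `H¹(G_n, E(K_n))`, `G_n = Gal(K_n/K) ≅ ℤ/pⁿ`, UNIFORMLY in `n`. Count: with `T_n = E(K_n)_tors`,
  `L_n = E(K_n)/T_n`, `Λ_n = L_n^{G_n} ⊇ E(K)/tors` (index `≤ |T_n^{G_n}| ≤ |E(K)_tors|`),
  `|H¹(G_n, E(K_n))| ≤ |H¹(G_n, T_n)| · |Ĥ⁰(G_n, L_n)| / h(L_n)`, `|H¹(G_n,T_n)| = |Ĥ⁰(G_n,T_n)| ≤ |E(K)_tors|`,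
  `h(L_n) = p^{n r_K − Σ_{1≤m≤n} a_m}` (`h(ℤ) = pⁿ`, `h(ℤ[ζ_{p^m}]) = 1/p`; `a_m` = multiplicity of the faithful
  `ℚ(ζ_{p^m})`-constituent of `E(K_n) ⊗ ℚ`), `|Ĥ⁰(G_n, L_n)| = [Λ_n : N L_n] ≤ p^{n(r_K−1) + c + v_p|E(K)_tors|}`
  because `N L_n ⊇ pⁿ Λ_n + ℤ·N(P_n)` and `N(P_n) ∉ p^c E(K) + tors`; so `|H¹| ≤ B · p^{c' + Σ_{m≤n}(a_m − 1)}`,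
  and `r_K + Σ_{m≤n} φ(p^m) a_m = rank E(K_n) ≤ pⁿ + C₁` for all `n` forces `a_m ≥ 2` for only finitely many
  `m`, whence `Σ_{m≤n}(a_m − 1) ≤ C₃`. (Mathlib: `Rep.FiniteCyclicGroup`, `TateCohomology`; tree:
  `index_nsmul_inflClass`, `finite_range_inflClass`, Mordell–Weil `WeierstrassCurve.addGroup_fg_point_holds`,
  Galois descent `fixedPoints_eq_range_map_holds`.)
* **S3 · `stub_capitulationInflation`** (INFLATION–RESTRICTION at a layer; provable now, size M): for any
  number field `K`, `W/K`, `κ`, `n`: a class of `Ш(W/K)` restricting to `0` in `Ш(W/K_n)` is, in `H¹(K, E)`,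
  the inflation of a crossed homomorphism vanishing on `Γ_{K_n} = κ.layerSubgroup n` (tree:
  `mem_ker_resBaseChange_iff`, `resKer_le_range_inflClass`, `galSubgroupClosure_le_range_resGal`; the layer is
  Galois — `ZpExtension.isGalois_layer_holds` — so its Galois closure in `K̄` is itself and
  `Γ_{K̃_n} = κ.layerSubgroup n` by `ZpExtension.fixingSubgroup_layer`).

`NormHerbrandBound_of` is sorry-free logic: `C₁` from S1, `C₂` from S2 (at `W = V_K`, with the crux's datum),
and for a capitulating `ξ`, S3 writes `ξ = infl f`, so `p^{C₂} • ξ = 0` in `Ш ⊆ H¹(K, E)`; `C := C₂`.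

Disproof.lean: none exists for this crux (`ledger crux ls stmt-BirchSwinnertonDyer-17970`: no workfiles before
this one) — no `_false_without_` obstruction to honour, no landed Negative lemma to avoid. Negatives index of the
summit: one refuted statement (LeadingTerm `TamePinch`, CM curves have no admissible surjective `p`) — not an
instance of any stub (S1 asks irreducibility only, S2/S3 have no image hypothesis at all).

BC3 probes (planner folder `bc/probe_S{1,2,3}_*.lean`, `bc/probe_S3c_variants.lean`, 2026-08-17; every tactic
its own `example`, `maxHeartbeats 400000`): for each stub `S`, `S → NormHerbrandBound` and
`S → BirchSwinnertonDyer` by the battery `first | exact? | simpa | aesop` FAIL (unsolved goals), and separately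
`exact?` ("could not close the goal"), `simpa` (assumption failed) and `aesop (terminal := true)` (failed after
exhaustive search) FAIL; the only non-verdicts are heartbeat TIMEOUTS of the variants that `unfold`/`simp` the
large crux statement (gate ground flag: binders 16 / size 411261), and of folded `exact?` on `S3 → crux` (first-order unification of the `∈ range`
hypothesis against the folded constant) — re-run with the crux unfolded and its binders introduced, `exact?`,
`aesop` and `simp_all` all FAIL outright. No stub is cheaply the crux or the summit. Details: `Lines/birth.md`.
-/

set_option linter.unusedVariables false
set_option linter.dupNamespace false

noncomputable section

namespace Summit.BirchSwinnertonDyer.BirchSwinnertonDyer.Cruxes.NormHerbrandBound.Birth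

open scoped BigOperators Classical
open Summit.BirchSwinnertonDyer.BirchSwinnertonDyer.Theses.NormCapitulation
open Literature Literature.NumberTheory.EllipticCurves

/-! ## Registered stubs -/

/-- **S1 · `stub_towerRankGrowth` — MORDELL–WEIL GROWS LIKE `pⁿ + O(1)` IN THE ANTICYCLOTOMIC TOWER OVER A
HEEGNER FIELD** (the Iwasawa input). Hypotheses: exactly the crux's (no universal-norm datum). Conclusion:
`∃ C₁ ∀ n, rank_ℤ E(K_n) ≤ pⁿ + C₁` with `E(K_n) = E(K̄)^{Γ_{K_n}} ⊆ E(K̄) = (V_K).geomPoints`.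
Theorem under Howard's hypotheses (big `p`-adic image, `p ∤ h_K d_K N`): Λ-corank one of the anticyclotomic
Selmer group + control; open in print for irreducible non-surjective `ρ̄` and for `p ∣ h_K`.
[cite: Howard2004HeegnerKolyvagin, Thm. B] [cite: CornutVatsal2007] [cite: Cornut2002]
[cite: Bertolini1995] [cite: arXiv:1908.09512] [cite: GreenbergLNM1716, §1] -/
theorem stub_towerRankGrowth :
    ∀ (V : WeierstrassCurve ℚ) [V.IsElliptic] [V.IsGloballyMinimal] (p : ℕ) [Fact p.Prime], 5 ≤ p →
      V.HasGoodReductionAtPrime p → ¬ (p : ℤ) ∣ V.frobeniusTrace p → V.HasIrreducibleModPGaloisRep p →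
      ∀ (K : Type) [Field K] [NumberField K], (Module.finrank ℚ K = 2 ∧ NumberField.IsTotallyComplex K ∧
        NumberField.discr K < -4 ∧ Int.gcd (NumberField.discr K) (V.conductorNorm ℤ * p) = 1 ∧
        (∀ q : ℕ, q.Prime → q ∣ V.conductorNorm ℤ →
          ((Ideal.span {(q : ℤ)}).primesOver (NumberField.RingOfIntegers K)).ncard = 2)) →
      ∀ κ : Literature.NumberTheory.EllipticCurves.ZpExtension K p, κ.IsAnticyclotomic →
      ∃ C₁ : ℕ, ∀ n : ℕ,
        Module.finrank ℤ ↥(FixedPoints.addSubgroup ↥(κ.layerSubgroup n) (V.baseChange K).geomPoints) ≤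
          p ^ n + C₁ := by
  sorry

/-- **S2 · `stub_herbrandCount` — THE HERBRAND COUNT** (integral representation theory of
`ℤ[ℤ/pⁿ]`-lattices, uniform in `n`). For any number field `K`, any `ℤ_p`-extension `κ` of `K` and any elliptic
`W/K`: a `p`-adic universal-norm datum (`∃ c ∀ n ∃ P_n ∈ E(K_n)`, `N_{K_n/K} P_n ∉ p^c E(K) + tors`) and the
growth bound `rank E(K_n) ≤ pⁿ + C₁` give `C₂` such that `p^{C₂}` kills every class of `H¹(K, E)` inflated
from a crossed homomorphism `Γ_K → E(K̄)` vanishing on `Γ_{K_n}` — i.e. kills `H¹(Gal(K_n/K), E(K_n))` —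
for EVERY `n`. (`|H¹(G_n, E(K_n))| ≤ |E(K)_tors| · [Λ_n : N L_n] / h(L_n)` with `h(ℤ) = pⁿ`,
`h(ℤ[ζ_{p^m}]) = 1/p`, `[Λ_n : N L_n] ≤ p^{n(r_K − 1) + c + v_p |E(K)_tors|}` from the universal norm, and
`Σ_{m≤n} (a_m − 1) = O(1)` from the growth bound.)
[cite: SerreLocalFields1979, VIII.§4 (Herbrand quotient)] [cite: Mazur1972]
[cite: PerrinRiou1987BSMF] [cite: Bertolini1995] [cite: SilvermanAEC2009, VIII.§1 and App. B] -/
theorem stub_herbrandCount :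
    ∀ (K : Type) [Field K] [NumberField K] (W : WeierstrassCurve K) [W.IsElliptic] (p : ℕ) [Fact p.Prime]
      (κ : Literature.NumberTheory.EllipticCurves.ZpExtension K p),
      (∃ c : ℕ, ∀ n : ℕ, ∃ P : W.geomPoints, (∀ τ ∈ κ.layerSubgroup n, τ • P = P) ∧
        ∃ σ : ZMod (p ^ n) → Field.absoluteGaloisGroup K,
          (∀ a : ZMod (p ^ n), PadicInt.toZModPow n (Multiplicative.toAdd (κ (σ a))) = a) ∧
          ∀ Q : W.geomPoints, (∀ g : Field.absoluteGaloisGroup K, g • Q = Q) →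
            ∀ m : ℕ, 0 < m → m • ((∑ a : ZMod (p ^ n), σ a • P) - p ^ c • Q) ≠ 0) →
      ∀ C₁ : ℕ, (∀ n : ℕ,
        Module.finrank ℤ ↥(FixedPoints.addSubgroup ↥(κ.layerSubgroup n) W.geomPoints) ≤ p ^ n + C₁) →
      ∃ C₂ : ℕ, ∀ (n : ℕ)
        (f : Literature.NumberTheory.EllipticCurves.cocyclesVanishingOn W.geomPoints (κ.layerSubgroup n)),
        p ^ C₂ • Literature.NumberTheory.EllipticCurves.inflClass W.geomPoints (κ.layerSubgroup n)
          (κ.isOpen_layerSubgroup n) f = 0 := by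
  sorry

/-- **S3 · `stub_capitulationInflation` — THE CAPITULATION KERNEL IS INFLATED** (inflation–restriction at
the layer `K_n`; provable now from the tree). For any number field `K`, any `W/K`, any `ℤ_p`-extension `κ`
and any `n`: a class of `Ш(W/K)` that restricts to `0` in `Ш(W_{K_n}/K_n)` is, as a class of `H¹(K, E)`, the
inflation of a crossed homomorphism `Γ_K → E(K̄)` vanishing on `Γ_{K_n} = κ.layerSubgroup n` (the layer is
Galois over `K`, so its Galois closure in `K̄` is itself and `Gal(K̄/K_n) = κ⁻¹(pⁿℤ_p)`).
[cite: SerreGaloisCohomology1997, I.§5.8 (inflation–restriction)] [cite: SilvermanAEC2009, App. B.2]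
[cite: Washington1997, §13.1] -/
theorem stub_capitulationInflation :
    ∀ (K : Type) [Field K] [NumberField K] (W : WeierstrassCurve K) (p : ℕ) [Fact p.Prime]
      (κ : Literature.NumberTheory.EllipticCurves.ZpExtension K p) (n : ℕ) (_ : NumberField ↥(κ.layer n))
      (ξ : ↥W.sha),
      Literature.NumberTheory.EllipticCurves.shaRestriction W ↥(κ.layer n) ξ = 0 →
      (ξ : W.galH1) ∈ (Literature.NumberTheory.EllipticCurves.inflClass W.geomPoints (κ.layerSubgroup n)
        (κ.isOpen_layerSubgroup n)).range := by
  sorry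

/-! ## Stub statements by name -/

namespace Statement

/-- Statement of `stub_towerRankGrowth`. -/
abbrev stub_towerRankGrowth : Prop := type_of% @Birth.stub_towerRankGrowth
/-- Statement of `stub_herbrandCount`. -/
abbrev stub_herbrandCount : Prop := type_of% @Birth.stub_herbrandCount
/-- Statement of `stub_capitulationInflation`. -/
abbrev stub_capitulationInflation : Prop := type_of% @Birth.stub_capitulationInflation

end Statement

/-! ## The composition (sorry-free) -/

/-- **`NormHerbrandBound_of`** — the three stub STATEMENTS imply the crux, BY NAME. Logic only: `C₁` from
S1 (tower rank growth at `(V, p, K, κ)`), `C₂` from S2 (the Herbrand count for `W = V_K` with the crux's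
universal-norm datum and `C₁`); a capitulating class `ξ` is inflated from `Γ_{K_n}` (S3), hence killed by
`p^{C₂}` in `H¹(K, E)`, hence in `Ш(E/K)`. -/
theorem NormHerbrandBound_of (h1 : Statement.stub_towerRankGrowth) (h2 : Statement.stub_herbrandCount)
    (h3 : Statement.stub_capitulationInflation) : NormHerbrandBound := by
  intro V iV iM p ip h5 hgood hord hirr K iF iN hK κ hκ hUN
  obtain ⟨C₁, hC₁⟩ := h1 V p h5 hgood hord hirr K hK κ hκ
  haveI : (V.baseChange K).IsElliptic := by
    rw [WeierstrassCurve.baseChange]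
    infer_instance
  obtain ⟨C₂, hC₂⟩ := h2 K (V.baseChange K) p κ hUN C₁ hC₁
  refine ⟨C₂, fun n iL ξ _ hres => ?_⟩
  obtain ⟨f, hf⟩ := h3 K (V.baseChange K) p κ n iL ξ hres
  apply Subtype.ext
  change ((p ^ C₂ • ξ : ↥(V.baseChange K).sha) : (V.baseChange K).galH1) = 0
  rw [AddSubgroupClass.coe_nsmul, ← hf]
  exact hC₂ n f

/-- The crux along this line, MODULO the three registered stubs (sorries live only in `stub_*`). -/
theorem NormHerbrandBound_proof : NormHerbrandBound :=
  NormHerbrandBound_of stub_towerRankGrowth stub_herbrandCount stub_capitulationInflation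

end Summit.BirchSwinnertonDyer.BirchSwinnertonDyer.Cruxes.NormHerbrandBound.Birth

end
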